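/-
Copyright (c) 2026. All rights reserved.
Released under Apache 2.0 license as described in the file LICENSE.
Authors: HodgeCM publication cell (pub-hodgecm), GR lane, seat GR-2 (`pub-hodgecm-own-hyp34`).
-/
import Literature.NumberTheory.Weil1964.ArchFollandFrameGen
import HarnessLib

/-!
# The scaled Folland frame of `W_∞` with a coordinate twist at the complex places

Topic `NumberTheory/Weil1964`; namespace `Literature.NumberTheory.Weil1964` (continues `ArchFollandFrameGen`).  KERNEL
ONLY: definitions with bodies and theorems; no `def … : Prop` record, no `axiom`, no proof hole.

`ArchFollandFrameGen.scaledFrameGen` reads the complex coordinate of `a ∈ (F ⊗ ℝ)^ι` at a complex place `v` through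
Mathlib's `σ_v`.  For a quadratic extension `E/F` the natural coordinate at `v` is `σ_w|_F` for a chosen place `w` of
`E` over `v`, which is `σ_v` or its complex conjugate (`ArchActQuadraticComplexPlaces.placeTwist`).  This file twists
the frame by a family `ψ_v : ℂ →+* ℂ` of CONTINUOUS ring endomorphisms (each `= id` or `conj`,
`twist_eq_id_or_conj`):

* §1 `ψ_v` is an involution, preserves real parts, is `ℝ`-linear, and `re(ψ x · y) = re(x · ψ y)`;
* §2 **`twistVec ψ : (F ⊗ ℝ)^ι ≃L[ℝ] (F ⊗ ℝ)^ι`** (identity on real coordinates, `ψ_v` on the complex coordinate at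
  `v`), an involution, SELF-ADJOINT for the trace pairing (`piTracePairing_twistVec`);
* §3 **`scaledFrameGenT ψ D C := twistVec ψ ≫ scaledFrameGen D C`** and its slices: real slices unchanged, complex
  slice `reImVec (C · ψ_v(a_v))`; `follandFreq e_T w = follandFreq e (twistVec w)`;
* §4 the Folland coordinates `Ξ_{e_T}(a, w) = (e_T a, follandFreq e_T (T_∞ w))` of an `F`-rational Gram matrix
  `T = T₀ ⊗ 1`, slice by slice: real slice = `follandScale` (unchanged), complex slice
  **`cxFollandScale C (T₀.map (ψ_v ∘ σ_v)) (ψ_v a_v, ψ_v w_v)`** — the Gram matrix at `v` is read through `ψ_v ∘ σ_v`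
  (`= σ_w|_F` in the application), exactly the Gram matrix `σ_w(T₀) ⊗ 1` of the `(w, cw)`-factor
  (`UnitaryGroupArchComplexPair.archAtComplexSplit`).

[Folland1989, §1.3 (1.25), Prop. (1.43)]: Folland coordinates and their covariance; [Weil1964, Chap. III n° 37]: the
archimedean factor of the adelic symplectic space; no analysis here.

## References
* [Folland1989] G. B. Folland, *Harmonic Analysis in Phase Space*, Princeton UP (1989), §1.3 (1.25), Prop. (1.43).
* [Weil1964] A. Weil, *Sur certains groupes d'opérateurs unitaires*, Acta Math. 111 (1964), Chap. III n° 37–38.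
-/

set_option autoImplicit false

noncomputable section

open scoped Matrix Real Classical ComplexConjugate
open Complex NumberField NumberField.InfinitePlace NumberField.mixedEmbedding IsDedekindDomain
open Literature.NumberTheory.Automorphic
open Literature.RepresentationTheory.HeisenbergGroup Literature.Analysis.SegalBargmann

namespace Literature.NumberTheory.Weil1964

variable {F : Type} [Field F] [NumberField F] {ι : Type} [Fintype ι] [DecidableEq ι]

/-! ## §1 Continuous ring endomorphisms of `ℂ` -/

section Endo

variable (ψ : {v : InfinitePlace F // v.IsComplex} → (ℂ →+* ℂ)) (hψ : ∀ v, Continuous (ψ v))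

omit [NumberField F] in
include hψ in
/-- each `ψ_v` is the identity or complex conjugation. [cite: Folland1989, Ch. 4 §1 Prop. (4.6)] -/
theorem twist_eq_id_or_conj (v : {v : InfinitePlace F // v.IsComplex}) :
    ψ v = RingHom.id ℂ ∨ ψ v = starRingEnd ℂ :=
  Complex.ringHom_eq_id_or_conj_of_continuous (hψ v)

omit [NumberField F] in
include hψ in
/-- `ψ_v` is an involution. [cite: Folland1989, Ch. 4 §1 Prop. (4.6)] -/
@[simp] theorem twist_twist (v : {v : InfinitePlace F // v.IsComplex}) (z : ℂ) : ψ v (ψ v z) = z := by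
  rcases twist_eq_id_or_conj ψ hψ v with h | h <;> rw [h]
  · rfl
  · exact Complex.conj_conj z

omit [NumberField F] in
include hψ in
/-- `ψ_v` preserves real parts. [cite: Folland1989, Ch. 4 §1 Prop. (4.6)] -/
theorem re_twist (v : {v : InfinitePlace F // v.IsComplex}) (z : ℂ) : (ψ v z).re = z.re := by
  rcases twist_eq_id_or_conj ψ hψ v with h | h <;> rw [h]
  · rfl
  · exact Complex.conj_re z

omit [NumberField F] in
include hψ in
/-- `ψ_v` is `ℝ`-linear. [cite: Folland1989, Ch. 4 §1 Prop. (4.6)] -/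
theorem twist_ofReal_mul (v : {v : InfinitePlace F // v.IsComplex}) (r : ℝ) (z : ℂ) :
    ψ v ((r : ℂ) * z) = (r : ℂ) * ψ v z := by
  rcases twist_eq_id_or_conj ψ hψ v with h | h <;> rw [h]
  · rfl
  · rw [map_mul, Complex.conj_ofReal]

omit [NumberField F] in
include hψ in
/-- **`re(ψ x · y) = re(x · ψ y)`** — the twist is self-adjoint for the trace form `2 re(x y)`.
[cite: Folland1989, Ch. 4 §1 Prop. (4.6)] -/
theorem re_twist_mul (v : {v : InfinitePlace F // v.IsComplex}) (x y : ℂ) : (ψ v x * y).re = (x * ψ v y).re := by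
  conv_lhs => rw [← re_twist ψ hψ v (ψ v x * y), map_mul, twist_twist ψ hψ]

end Endo

/-! ## §2 The twist of archimedean vectors -/

section TwistVec

variable (ψ : {v : InfinitePlace F // v.IsComplex} → (ℂ →+* ℂ)) (hψ : ∀ v, Continuous (ψ v))

variable (ι) in
include hψ in
/-- **`twistVec ψ : (F ⊗ ℝ)^ι ≃L[ℝ] (F ⊗ ℝ)^ι`**: identity on the real coordinates, `ψ_v` on the complex coordinate at
`v`; an involution. [cite: Folland1989, §1.3 (1.25)] -/
def twistVec : (ι → mixedSpace F) ≃L[ℝ] (ι → mixedSpace F) :=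
  LinearEquiv.toContinuousLinearEquiv
    { toFun := fun a j => ((a j).1, fun v => ψ v ((a j).2 v))
      invFun := fun a j => ((a j).1, fun v => ψ v ((a j).2 v))
      map_add' := fun a b => by
        funext j
        refine Prod.ext rfl (funext fun v => ?_)
        simp only [Pi.add_apply, Prod.snd_add, map_add]
      map_smul' := fun r a => by
        funext j
        refine Prod.ext rfl (funext fun v => ?_)
        simp only [Pi.smul_apply, Prod.smul_snd, Complex.real_smul, RingHom.id_apply, twist_ofReal_mul ψ hψ]
      left_inv := fun a => by
        funext j
        refine Prod.ext rfl (funext fun v => ?_)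
        simp only [twist_twist ψ hψ]
      right_inv := fun a => by
        funext j
        refine Prod.ext rfl (funext fun v => ?_)
        simp only [twist_twist ψ hψ] }

omit [DecidableEq ι] in
/-- real coordinates are untouched. [cite: Folland1989, §1.3 (1.25)] -/
@[simp] theorem twistVec_apply_fst (a : ι → mixedSpace F) (j : ι) : (twistVec ι ψ hψ a j).1 = (a j).1 := rfl

omit [DecidableEq ι] in
/-- the complex coordinate at `v` is twisted by `ψ_v`. [cite: Folland1989, §1.3 (1.25)] -/
@[simp] theorem twistVec_apply_snd (a : ι → mixedSpace F) (j : ι) (v : {v : InfinitePlace F // v.IsComplex}) :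
    (twistVec ι ψ hψ a j).2 v = ψ v ((a j).2 v) := rfl

omit [DecidableEq ι] in
/-- the inverse twist is the twist. [cite: Folland1989, §1.3 (1.25)] -/
@[simp] theorem twistVec_symm_apply (a : ι → mixedSpace F) : (twistVec ι ψ hψ).symm a = twistVec ι ψ hψ a := rfl

omit [DecidableEq ι] in
/-- real slices are untouched. [cite: Folland1989, §1.3 (1.25)] -/
@[simp] theorem placeVec_twistVec (v : {v : InfinitePlace F // v.IsReal}) (a : ι → mixedSpace F) :
    placeVec F ι v (twistVec ι ψ hψ a) = placeVec F ι v a := rfl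

omit [DecidableEq ι] in
/-- complex slices are twisted. [cite: Folland1989, §1.3 (1.25)] -/
@[simp] theorem placeVecC_twistVec (v : {v : InfinitePlace F // v.IsComplex}) (a : ι → mixedSpace F) :
    placeVecC F ι v (twistVec ι ψ hψ a) = fun j => ψ v (placeVecC F ι v a j) := rfl

omit [DecidableEq ι] in
/-- **the twist is self-adjoint for the trace pairing**: `⟨twist u, w⟩_{Tr} = ⟨u, twist w⟩_{Tr}`.
[cite: Folland1989, §1.3 (1.25)] -/
theorem piTracePairing_twistVec (u w : ι → mixedSpace F) :
    piTracePairing F ι (twistVec ι ψ hψ u) w = piTracePairing F ι u (twistVec ι ψ hψ w) := by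
  rw [piTracePairing_apply, piTracePairing_apply]
  refine Finset.sum_congr rfl fun i _ => ?_
  rw [mixedTrace_apply, mixedTrace_apply]
  congr 1
  refine Finset.sum_congr rfl fun v _ => ?_
  rw [Prod.snd_mul, Prod.snd_mul, Pi.mul_apply, Pi.mul_apply, twistVec_apply_snd, twistVec_apply_snd,
    re_twist_mul ψ hψ]

omit [DecidableEq ι] in
/-- the twist of `T_∞ w` for an `F`-rational `T₀`, read at a complex place: `ψ_v(σ_v(T₀) w_v) = (ψ_v ∘ σ_v)(T₀) · ψ_v(w_v)`.
[cite: Weil1964, Chap. III n° 37] -/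
theorem placeVecC_twistVec_archMat_mulVec (T₀ : Matrix ι ι F) (w : ι → mixedSpace F)
    (v : {v : InfinitePlace F // v.IsComplex}) :
    placeVecC F ι v (twistVec ι ψ hψ (archMat F ι (T₀.map (algebraMap F (AdeleRing (𝓞 F) F))) *ᵥ w)) =
      (T₀.map ((ψ v).comp v.1.embedding)) *ᵥ fun j => ψ v (placeVecC F ι v w j) := by
  rw [placeVecC_twistVec, placeVecC_archMat_mulVec]
  funext j
  rw [RingHom.map_mulVec (ψ v) (T₀.map v.1.embedding) (placeVecC F ι v w) j, Matrix.map_map]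
  rfl

end TwistVec

/-! ## §3 The twisted scaled frame and its slices -/

section Frame

variable (ψ : {v : InfinitePlace F // v.IsComplex} → (ℂ →+* ℂ)) (hψ : ∀ v, Continuous (ψ v))
  (D : ι × {v : InfinitePlace F // v.IsReal} → ℝ) (hD : ∀ k, D k ≠ 0)
  (C : ι × {v : InfinitePlace F // v.IsComplex} → ℂ) (hC : ∀ k, C k ≠ 0)

variable (F ι) in
/-- **the twisted scaled frame** `e_T = scaledFrameGen ∘ twistVec ψ : (F ⊗ ℝ)^ι ≃L[ℝ] ℝ^{FrameIdx}`.
[cite: Folland1989, §1.3 (1.25)] -/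
def scaledFrameGenT : (ι → mixedSpace F) ≃L[ℝ] (FrameIdx F ι → ℝ) :=
  (twistVec ι ψ hψ).trans (scaledFrameGen F ι D hD C hC)

omit [DecidableEq ι] in
/-- unfolding. [cite: Folland1989, §1.3 (1.25)] -/
theorem scaledFrameGenT_apply (a : ι → mixedSpace F) :
    scaledFrameGenT F ι ψ hψ D hD C hC a = scaledFrameGen F ι D hD C hC (twistVec ι ψ hψ a) := rfl

omit [DecidableEq ι] in
/-- the inverse frame: untwist after the inverse scaled frame. [cite: Folland1989, §1.3 (1.25)] -/
theorem scaledFrameGenT_symm_apply (p : FrameIdx F ι → ℝ) :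
    (scaledFrameGenT F ι ψ hψ D hD C hC).symm p = twistVec ι ψ hψ ((scaledFrameGen F ι D hD C hC).symm p) := rfl

omit [DecidableEq ι] in
/-- **the real slice of the twisted frame**: unchanged, `(D_{j,v} (a_j)_v)_j`. [cite: Folland1989, §1.3 (1.25)] -/
theorem realSlice_scaledFrameGenT (v : {v : InfinitePlace F // v.IsReal}) (a : ι → mixedSpace F) :
    realSlice ι v (scaledFrameGenT F ι ψ hψ D hD C hC a) = fun j => D (j, v) * placeVec F ι v a j := rfl

omit [DecidableEq ι] in
/-- **the complex slice of the twisted frame**: `reImVec (C_{·,v} · ψ_v(a_v))`. [cite: Folland1989, §1.3 (1.25)] -/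
theorem cxSlice_scaledFrameGenT (v : {v : InfinitePlace F // v.IsComplex}) (a : ι → mixedSpace F) :
    cxSlice ι v (scaledFrameGenT F ι ψ hψ D hD C hC a) = reImVec ι fun j => C (j, v) * ψ v (placeVecC F ι v a j) := by
  rw [scaledFrameGenT_apply, cxSlice_scaledFrameGen, placeVecC_twistVec]

omit [DecidableEq ι] in
/-- **`follandFreq` in the twisted frame is `follandFreq` of the twisted vector** (the twist is a self-adjoint
involution for the trace pairing). [cite: Folland1989, §1.3 (1.25)] -/
theorem follandFreq_scaledFrameGenT (w : ι → mixedSpace F) (k : FrameIdx F ι) :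
    follandFreq F ι (scaledFrameGenT F ι ψ hψ D hD C hC) w k =
      follandFreq F ι (scaledFrameGen F ι D hD C hC) (twistVec ι ψ hψ w) k := by
  rw [follandFreq, follandFreq, scaledFrameGenT_symm_apply, piTracePairing_twistVec]

end Frame

/-! ## §4 The Folland coordinates of `T = T₀ ⊗ 1` in the twisted frame, slice by slice -/

section Folland

variable (ψ : {v : InfinitePlace F // v.IsComplex} → (ℂ →+* ℂ)) (hψ : ∀ v, Continuous (ψ v))
  {D : ι × {v : InfinitePlace F // v.IsReal} → ℝ} {hD : ∀ k, D k ≠ 0}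
  {C : ι × {v : InfinitePlace F // v.IsComplex} → ℂ} {hC : ∀ k, C k ≠ 0}

/-- the real slice of `(Ξ_{e_T}(a, w)).2` for a general `F`-rational `T₀` (untwisted). [cite: Folland1989, Prop. (1.43)] -/
theorem realSlice_archFolland_twist_snd (T₀ : Matrix ι ι F) (a w : ι → mixedSpace F) (v : {v : InfinitePlace F // v.IsReal}) :
    realSlice ι v (archFolland (T₀.map (algebraMap F (AdeleRing (𝓞 F) F))) (scaledFrameGenT F ι ψ hψ D hD C hC) (a, w)).2 =
      fun j => -(((T₀.map (embedding_of_isReal v.2)) *ᵥ placeVec F ι v w) j) / D (j, v) := by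
  funext j
  rw [realSlice_apply, archFolland_snd, follandFreq_scaledFrameGenT, follandFreq_scaledFrameGen_inl, twistVec_apply_fst,
    ← placeVec_apply (F := F) (ι := ι) v, placeVec_archMat_mulVec]

/-- **the real slice is the untwisted one** (general `F`-rational `T₀`). [cite: Folland1989, Prop. (1.43)] -/
theorem realSlice_archFolland_twist (T₀ : Matrix ι ι F) (a w : ι → mixedSpace F) (v : {v : InfinitePlace F // v.IsReal}) :
    (realSlice ι v (archFolland (T₀.map (algebraMap F (AdeleRing (𝓞 F) F))) (scaledFrameGenT F ι ψ hψ D hD C hC) (a, w)).1,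
      realSlice ι v (archFolland (T₀.map (algebraMap F (AdeleRing (𝓞 F) F))) (scaledFrameGenT F ι ψ hψ D hD C hC) (a, w)).2) =
      ((fun j => D (j, v) * placeVec F ι v a j),
        fun j => -(((T₀.map (embedding_of_isReal v.2)) *ᵥ placeVec F ι v w) j) / D (j, v)) :=
  Prod.ext (realSlice_scaledFrameGenT ψ hψ D hD C hC v a) (realSlice_archFolland_twist_snd ψ hψ T₀ a w v)

/-- for DIAGONAL `T₀ = diag(t₀)` the real slice is the adapted Folland scaling `follandScale` — verbatim the untwisted
formula. [cite: Folland1989, Prop. (1.43)] -/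
theorem realSlice_archFolland_twist_diagonal (t₀ : ι → F) (a w : ι → mixedSpace F) (v : {v : InfinitePlace F // v.IsReal}) :
    (realSlice ι v (archFolland ((Matrix.diagonal t₀).map (algebraMap F (AdeleRing (𝓞 F) F)))
        (scaledFrameGenT F ι ψ hψ D hD C hC) (a, w)).1,
      realSlice ι v (archFolland ((Matrix.diagonal t₀).map (algebraMap F (AdeleRing (𝓞 F) F)))
        (scaledFrameGenT F ι ψ hψ D hD C hC) (a, w)).2) =
      follandScale (fun j => D (j, v)) (fun j => embedding_of_isReal v.2 (t₀ j))
        (placeVec F ι v a, placeVec F ι v w) := by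
  rw [realSlice_archFolland_twist, follandScale_apply]
  refine Prod.ext rfl (funext fun j => ?_)
  have hdiag : (Matrix.diagonal t₀).map (embedding_of_isReal v.2) = Matrix.diagonal fun j => embedding_of_isReal v.2 (t₀ j) :=
    Matrix.diagonal_map (map_zero _)
  simp only [hdiag, Matrix.mulVec_diagonal]
  ring

/-- the complex slice of `(Ξ_{e_T}(a, w)).2`: `reImVec (-2 conj(((ψ_v ∘ σ_v) T₀ · ψ_v w_v) / C))`.
[cite: Folland1989, Prop. (1.43)] -/
theorem cxSlice_archFolland_twist_snd (T₀ : Matrix ι ι F) (a w : ι → mixedSpace F) (v : {v : InfinitePlace F // v.IsComplex}) :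
    cxSlice ι v (archFolland (T₀.map (algebraMap F (AdeleRing (𝓞 F) F))) (scaledFrameGenT F ι ψ hψ D hD C hC) (a, w)).2 =
      reImVec ι fun j => -2 * conj (((T₀.map ((ψ v).comp v.1.embedding)) *ᵥ fun j => ψ v (placeVecC F ι v w j)) j / C (j, v)) := by
  have hw : ∀ j : ι, ((twistVec ι ψ hψ (archMat F ι (T₀.map (algebraMap F (AdeleRing (𝓞 F) F))) *ᵥ w)) j).2 v =
      ((T₀.map ((ψ v).comp v.1.embedding)) *ᵥ fun j => ψ v (placeVecC F ι v w j)) j := fun j => by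
    rw [← placeVecC_apply (F := F) (ι := ι) v, placeVecC_twistVec_archMat_mulVec]
  funext i
  rcases i with j | j
  · rw [cxSlice_apply, archFolland_snd, follandFreq_scaledFrameGenT, follandFreq_scaledFrameGen_inr_inl, reImVec_inl, hw,
      div_eq_mul_inv]
    simp only [Complex.mul_re, Complex.neg_re, Complex.neg_im, Complex.conj_re, Complex.conj_im, Complex.re_ofNat,
      Complex.im_ofNat]
    ring
  · rw [cxSlice_apply, archFolland_snd, follandFreq_scaledFrameGenT, follandFreq_scaledFrameGen_inr_inr, reImVec_inr, hw,
      div_eq_mul_inv]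
    simp only [Complex.mul_im, Complex.neg_re, Complex.neg_im, Complex.conj_re, Complex.conj_im, Complex.re_ofNat,
      Complex.im_ofNat]
    ring

/-- **the complex slice in the twisted frame**: `cxFollandScale C_{·,v} ((ψ_v ∘ σ_v)(T₀)) (ψ_v a_v, ψ_v w_v)` — the Gram
matrix at `v` read through `ψ_v ∘ σ_v`. [cite: Folland1989, Prop. (1.43)] -/
theorem cxSlice_archFolland_twist (T₀ : Matrix ι ι F) (a w : ι → mixedSpace F) (v : {v : InfinitePlace F // v.IsComplex}) :
    (cxSlice ι v (archFolland (T₀.map (algebraMap F (AdeleRing (𝓞 F) F))) (scaledFrameGenT F ι ψ hψ D hD C hC) (a, w)).1,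
      cxSlice ι v (archFolland (T₀.map (algebraMap F (AdeleRing (𝓞 F) F))) (scaledFrameGenT F ι ψ hψ D hD C hC) (a, w)).2) =
      cxFollandScale ι (fun j => C (j, v)) (T₀.map ((ψ v).comp v.1.embedding))
        ((fun j => ψ v (placeVecC F ι v a j)), fun j => ψ v (placeVecC F ι v w j)) :=
  Prod.ext (cxSlice_scaledFrameGenT ψ hψ D hD C hC v a) (cxSlice_archFolland_twist_snd ψ hψ T₀ a w v)

end Folland

end Literature.NumberTheory.Weil1964

end
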